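import Literature.NumberTheory.Sieve.CFSemigroupCriticalExponent
import Literature.NumberTheory.Sieve.CFSemigroupCongruence
import Literature.NumberTheory.Sieve.CFSemigroupNormCount
import Literature.NumberTheory.LFunctions.EffectivePerronOrderTwo
import HarnessLib

/-!
# From a continuation of the class Dirichlet series to a power saving for the congruence count of `Γ_A`

[MageeOhWinter2019, Thm. 1] (`MageeOhWinter2019_uniformCounting`) asserts
`#{γ ∈ Γ_A : ‖γ‖_F ≤ R, γ ≡ ξ (q)} = c R^{2δ_A}/#SL₂(ℤ/qℤ) + O(q^C R^{2δ_A − ε})`. In the paper this follows from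
the spectral bounds for the congruence transfer operators [Thm. 4] through the renewal/Laplace-transform analysis
of §3.4 (Lemma 15 – Prop. 17). This file isolates, in the vocabulary of the fact (`cfCount`, `cfDimension`), the
purely Tauberian last step, PROVED: writing

  `D_ξ(s) = Σ_{γ ∈ Γ_A, γ ≡ ξ (q)} ‖γ‖_F^{−2s}`   (`cfClassDirichlet A q ξ s`; absolutely convergent for
  `Re s > δ_A`, `summable_cfNormSq_rpow_neg`, from the critical exponent `summable_cfSemigroup_iff`),

**if** `D_ξ(s) = r/(s − δ_A) + H(s)` on `Re s > δ_A` with `r ≥ 0` and `H` holomorphic on `Re s > σ₀` of finite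
order `‖H(u+it)‖ ≤ M(1+|t|)^κ` (`κ < 2`) on `σ₁ ≤ u ≤ δ_A + 1` (`0 ≤ σ₀ < σ₁ < δ_A`), **then** for `R ≥ √2`

  `|cfCount A q ξ R − r R^{2δ_A}/δ_A| ≤ (r(2^{δ_A+1} + 1/δ_A) + M·(32/π)2^{2+σ₁}S(σ₁,κ)) · R^{2δ_A − 2(δ_A−σ₁)/3}`

(`cfCount_powerSaving_of_continuation`): a power saving with a constant LINEAR in `r` and `M`, so that bounds
`M ≪ q^C` uniform in the residue class give exactly the shape of [MageeOhWinter2019, Thm. 1]. The engine is the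
order-two effective Perron inversion `PerronTwo.abs_countFn_sub_main_le` of
`LFunctions/EffectivePerronOrderTwo.lean`, applied to the countable family `γ ↦ ‖γ‖_F²` on the class (weights `1`).
What is NOT proved here is the hypothesis: a continuation of `D_ξ` with a finite-order bound is analytic input of
the strength of [MageeOhWinter2019, Thm. 4 with §3.2–3.4] (Dolgopyat bounds and expansion; note that the paper
organises the last step through the renewal function of the boundary coding and a sandwich [Lemma 13, Lemma 18]
rather than through `D_ξ` itself, whose continuation it does not state).

## References
* [MageeOhWinter2019] M. Magee, H. Oh, D. Winter, J. reine angew. Math. 753 (2019), Thm. 1, Thm. 4, §3.4.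
-/

noncomputable section

open Complex Filter Set Real
open scoped MatrixGroups Topology

namespace Literature.NumberTheory.Sieve

open Literature.NumberTheory.LFunctions

variable {A : Finset ℕ}

/-! ### The class, the Frobenius norm squared, the class Dirichlet series -/

/-- The elements of `Γ_A` reducing to `ξ` modulo `q`. [cite: MageeOhWinter2019, §1] -/
abbrev cfClassElements (A : Finset ℕ) (q : ℕ) (ξ : SL(2, ZMod q)) : Type :=
  {γ : SL(2, ℤ) // (γ : Matrix (Fin 2) (Fin 2) ℤ) ∈ cfSemigroup A ∧ cfRed q γ = ξ}

/-- `‖γ‖_F² ≥ 1` on `SL₂(ℤ)` (the first row of a determinant-one matrix is non-zero; `cfNormSq` of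
`CFSemigroupNormCount`). [folklore] -/
theorem one_le_cfNormSq_coe (γ : SL(2, ℤ)) : 1 ≤ cfNormSq (γ : Matrix (Fin 2) (Fin 2) ℤ) := by
  have hdet := Matrix.SpecialLinearGroup.det_coe γ
  rw [Matrix.det_fin_two] at hdet
  set M := (γ : Matrix (Fin 2) (Fin 2) ℤ)
  have hrow : (1 : ℤ) ≤ M 0 0 ^ 2 + M 0 1 ^ 2 := by
    by_contra h
    have ha : M 0 0 = 0 := by nlinarith [sq_nonneg (M 0 0), sq_nonneg (M 0 1)]
    have hb : M 0 1 = 0 := by nlinarith [sq_nonneg (M 0 0), sq_nonneg (M 0 1)]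
    rw [ha, hb] at hdet; simp at hdet
  have hrow' : (1 : ℝ) ≤ ((M 0 0 : ℤ) : ℝ) ^ 2 + ((M 0 1 : ℤ) : ℝ) ^ 2 := by exact_mod_cast hrow
  unfold cfNormSq
  simp only [Fin.sum_univ_two]
  nlinarith [sq_nonneg (((M 1 0 : ℤ) : ℝ)), sq_nonneg (((M 1 1 : ℤ) : ℝ))]

/-- `SL₂(ℤ)` is countable. [folklore] -/
instance : Countable SL(2, ℤ) := by
  haveI : Countable (Matrix (Fin 2) (Fin 2) ℤ) := inferInstanceAs (Countable (Fin 2 → Fin 2 → ℤ))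
  exact Subtype.countable

/-- The **class Dirichlet series** `D_ξ(s) = Σ_{γ ∈ Γ_A, γ ≡ ξ (q)} ‖γ‖_F^{−2s}` (as the generalized Dirichlet series
of the family `γ ↦ ‖γ‖_F²` on the class). [cite: MageeOhWinter2019, §3 (the transforms `n_q`)] -/
def cfClassDirichlet (A : Finset ℕ) (q : ℕ) (ξ : SL(2, ZMod q)) (s : ℂ) : ℂ :=
  ∑' γ : cfClassElements A q ξ, ((cfNormSq (γ.1 : Matrix (Fin 2) (Fin 2) ℤ) : ℝ) : ℂ) ^ (-s)

/-- `D_ξ` is the (unweighted) generalized Dirichlet series of the family `γ ↦ ‖γ‖_F²` on the class. [folklore] -/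
theorem dirSeries_one_cfNormSq (q : ℕ) (ξ : SL(2, ZMod q)) (s : ℂ) :
    PerronTwo.dirSeries (fun _ => 1) (fun γ : cfClassElements A q ξ => cfNormSq (γ.1 : Matrix (Fin 2) (Fin 2) ℤ)) s = cfClassDirichlet A q ξ s := by
  rw [PerronTwo.dirSeries, cfClassDirichlet]
  exact tsum_congr fun γ => by push_cast; ring

/-- **Absolute convergence of `D_ξ` for `Re s > δ_A`:** `Σ_{γ ≡ ξ} ‖γ‖_F^{−2σ} < ∞` for `σ > δ_A` (a sub-sum of the
Poincaré series, `summable_cfSemigroup_iff`). [cite: MageeOhWinter2019, §2.2] -/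
theorem summable_cfNormSq_rpow_neg (hA : ∀ a ∈ A, 1 ≤ a) (h2 : 2 ≤ A.card) (q : ℕ) (ξ : SL(2, ZMod q)) {σ : ℝ}
    (hσ : cfDimension A < σ) : Summable fun γ : cfClassElements A q ξ => cfNormSq (γ.1 : Matrix (Fin 2) (Fin 2) ℤ) ^ (-σ) := by
  have hσ0 : 0 ≤ σ := (cfDimension_pos hA h2).le.trans hσ.le
  have h := (summable_cfSemigroup_iff hA h2 hσ0).2 hσ
  have hinj : Function.Injective fun γ : cfClassElements A q ξ => (⟨γ.1, γ.2.1⟩ : cfElements A) := by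
    intro γ γ' hγ
    have h1 := congrArg Subtype.val hγ
    exact Subtype.ext (by simpa using h1)
  exact (h.comp_injective hinj).congr fun γ => rfl

/-- **The Perron counting function of the family is the congruence count:** `#{γ ≡ ξ : ‖γ‖_F² ≤ R²} = cfCount A q ξ R`.
[folklore] -/
theorem countFn_cfNormSq_eq (hA : ∀ a ∈ A, 1 ≤ a) (h2 : 2 ≤ A.card) (q : ℕ) (ξ : SL(2, ZMod q)) (R : ℝ) :
    PerronTwo.countFn (fun _ => 1) (fun γ : cfClassElements A q ξ => cfNormSq (γ.1 : Matrix (Fin 2) (Fin 2) ℤ)) (R ^ 2) = (cfCount A q ξ R : ℝ) := by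
  have hs := summable_cfNormSq_rpow_neg hA h2 q ξ (σ := cfDimension A + 1) (by linarith)
  -- the class ball is the image of `{γ : ‖γ‖_F² ≤ R²}` under the (injective) inclusion
  have himage : (Subtype.val : cfClassElements A q ξ → SL(2, ℤ)) '' {γ | cfNormSq (γ.1 : Matrix (Fin 2) (Fin 2) ℤ) ≤ R ^ 2} =
      cfBallRes A q ξ R := by
    ext γ₀
    simp only [Set.mem_image, Set.mem_setOf_eq, cfBallRes]
    constructor
    · rintro ⟨γ, hγ, rfl⟩
      exact ⟨γ.2.1, hγ, γ.2.2⟩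
    · intro h
      exact ⟨⟨γ₀, h.1, h.2.2⟩, h.2.1, rfl⟩
  have hnc : ({γ : cfClassElements A q ξ | cfNormSq (γ.1 : Matrix (Fin 2) (Fin 2) ℤ) ≤ R ^ 2}).ncard = (cfBallRes A q ξ R).ncard := by
    rw [← himage, Set.ncard_image_of_injective _ Subtype.val_injective]
  rw [PerronTwo.countFn_one_eq_ncard (ℓ := fun γ : cfClassElements A q ξ => cfNormSq (γ.1 : Matrix (Fin 2) (Fin 2) ℤ)) (σ := cfDimension A + 1)
    (fun γ => one_le_cfNormSq_coe γ.1) (by linarith [cfDimension_pos hA h2]) hs (R ^ 2), cfCount_eq, hnc]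

/-! ### The bridge -/

/-- **Power saving for the congruence count from a finite-order continuation of the class Dirichlet series.**
For `A ⊂ ℕ_{≥1}`, `#A ≥ 2`, a level `q`, a class `ξ ∈ SL₂(ℤ/qℤ)`: if `D_ξ(s) = Σ_{γ ∈ Γ_A, γ ≡ ξ} ‖γ‖_F^{−2s}`
satisfies `D_ξ(s) = r/(s − δ_A) + H(s)` for `Re s > δ_A`, with `r ≥ 0`, `H` holomorphic on `Re s > σ₀`
(`0 ≤ σ₀ < σ₁ < δ_A`) and `‖H(u + it)‖ ≤ M (1+|t|)^κ` for `σ₁ ≤ u ≤ δ_A + 1` (`κ < 2`), then for all `R ≥ √2`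
`|cfCount A q ξ R − r R^{2δ_A}/δ_A| ≤ (r(2^{δ_A+1} + 1/δ_A) + M·(32/π)·2^{2+σ₁}·S(σ₁,κ)) · R^{2δ_A − 2(δ_A − σ₁)/3}`
(`S = PerronTwo.shiftConst`). With `r = c δ_A/#SL₂(ℤ/qℤ)` and `M ≤ K q^C` this is the conclusion of
[MageeOhWinter2019, Thm. 1] with `ε = 2(δ_A − σ₁)/3`; the hypothesis is what [MageeOhWinter2019, Thm. 4, §3] supply.
[cite: MageeOhWinter2019, Thm. 1 and §3.4] -/
theorem cfCount_powerSaving_of_continuation (hA : ∀ a ∈ A, 1 ≤ a) (h2 : 2 ≤ A.card) (q : ℕ) (ξ : SL(2, ZMod q))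
    {r σ₀ σ₁ : ℝ} (hr : 0 ≤ r) (hσ₀ : 0 ≤ σ₀) (hσ₀₁ : σ₀ < σ₁) (hσ₁ : σ₁ < cfDimension A)
    {H : ℂ → ℂ} (hH : DifferentiableOn ℂ H {s : ℂ | σ₀ < s.re})
    (hD : ∀ s : ℂ, cfDimension A < s.re → cfClassDirichlet A q ξ s = r / (s - cfDimension A) + H s)
    {κ M : ℝ} (hκ : κ < 2) (hM : 0 ≤ M)
    (hHb : ∀ u : ℝ, σ₁ ≤ u → u ≤ cfDimension A + 1 → ∀ t : ℝ, ‖H ((u : ℂ) + t * I)‖ ≤ M * (1 + |t|) ^ κ)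
    {R : ℝ} (hR : Real.sqrt 2 ≤ R) :
    |(cfCount A q ξ R : ℝ) - r * R ^ (2 * cfDimension A) / cfDimension A| ≤
      (r * (2 ^ (cfDimension A + 1) + 1 / cfDimension A) +
          M * (32 / π * 2 ^ (2 + σ₁) * PerronTwo.shiftConst σ₁ κ)) *
        R ^ (2 * cfDimension A - 2 * ((cfDimension A - σ₁) / 3)) := by
  have hδ := cfDimension_pos hA h2
  have hR0 : 0 ≤ R := (Real.sqrt_nonneg 2).trans hR
  have hx : 2 ≤ R ^ 2 := by
    have h := pow_le_pow_left₀ (Real.sqrt_nonneg 2) hR 2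
    rwa [Real.sq_sqrt (by norm_num)] at h
  have hmain := PerronTwo.abs_countFn_sub_main_le (a := fun _ => (1 : ℝ))
    (ℓ := fun γ : cfClassElements A q ξ => cfNormSq (γ.1 : Matrix (Fin 2) (Fin 2) ℤ)) (fun _ => zero_le_one) (fun γ => one_le_cfNormSq_coe γ.1) hδ
    (fun σ hσ => by simpa using summable_cfNormSq_rpow_neg hA h2 q ξ hσ) hr hσ₀ hσ₀₁ hσ₁ hH
    (fun s hs => by rw [dirSeries_one_cfNormSq]; exact hD s hs) hκ hM hHb hx
  rw [countFn_cfNormSq_eq hA h2] at hmain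
  have hpow : ∀ e : ℝ, (R ^ 2) ^ e = R ^ (2 * e) := fun e => by
    rw [show R ^ 2 = R ^ ((2 : ℕ) : ℝ) from (rpow_natCast R 2).symm, ← rpow_mul hR0]; norm_num
  rw [hpow, hpow] at hmain
  have hexp : 2 * (cfDimension A - (cfDimension A - σ₁) / 3) = 2 * cfDimension A - 2 * ((cfDimension A - σ₁) / 3) := by
    ring
  rw [hexp] at hmain
  exact hmain

end Literature.NumberTheory.Sieve
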